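/-
Copyright (c) 2026 the pub-hodgecm-mathlib formalisation cell (harness21).  Prover seat hodgecm-mathlib-LH4-p04 (g5), Track A «(D-RAM) FOUR-FRAME», unit U2H, the census leaf
(ρ2b′-X) `stub_U2H_fixedPointCensus_typeTwo_unit0` — socket (C) (type RamM bottom, dealer WORD #30: lead LH4-p04 + LH4-p06), organ (C-3): THE T5s-RamM WELD — the T5s
identity `toricCensusSum_ramM_v2` (EDITION 2 over ★ p857711, this lineage) with its abstract tables replaced by the census counts `#levelSet ∕ #levelSetDep`, modulo the per-cell facts (C-1)∕(C-2)
that LH4-p06 (g5) delivers (SOCKET (C) LEAD LINE #2, 2026-09-04T06:44Z).  2026-09-04.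
-/
import Summits.HodgeConjecture.HodgeConjecture.Theorems.F0P3cDyRamToricCensusSumRamMReindex   -- ★ p858024 (this seat): `levelSet_eq_empty_of_succ_le_ramified` (cells `a > j`); brings ★ RamMDep ∕ HEAD ∕ DEFS
import Summits.HodgeConjecture.HodgeConjecture.Theorems.F0P3cDyRamToricCensusSumRamMV2        -- T5s EDITION 2 `toricCensusSum_ramM_v2` (this seat; over ★ p857711 (LH4-p04 (g4)))
import HarnessLib

/-!
# T5c × T5s, type RamM: THE WELD — `ε·Σ_{j ≤ jλ} Σ_a q^a (#levelSetDep_h(j,a;μ) − #levelSetDep_{h′}(j,a;μ)) = q^m·(2[n_H+1]_q − 2[S]_q)`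

T5s EDITION 2 `toricCensusSum_ramM_v2` (this seat, over ★ p857711) is the census-sum identity over ABSTRACT tables `nP nM vP vM : ℕ → ℕ → ℚ` constrained by six hypotheses
(`hnP hnM hvGen hvOff hvTopNear hvTopFar`; parity token relaxed to «parity OR window», near top cells only asked to AGREE).
THIS FILE performs the substitution fixed in SOCKET (C) LEAD LINE #2: `nP j a := #levelSet_h(j,a)`, `nM j a := #levelSet_{h′}(j,a)`, `vP j a := [j ≤ jλ]·#levelSetDep_h(j,a;μ)`,
`vM j a := [j ≤ jλ]·#levelSetDep_{h′}(j,a;μ)` (cells `j > jλ` never enter the sum), and discharges the six T5s hypotheses from the NATURAL PER-CELL FACTS of the RamM level census —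
the deliverables (C-1P)∕(C-1M) (the u-free tables of both scalars, every cell, ℕ-currency) and (C-2GEN)∕(C-2OFF)∕(C-2TOPnear)∕(C-2TOPfar) (the depth rules on `a ≤ j ≤ jλ`: generic cells pass wholly,
off-diagonal non-generic cells are empty, NEAR diagonal top cells have EQUAL counts on the two sides, FAR ones carry the bit on side `ε` with value `2q^{j − (k′+1)∕2}`) that LH4-p06 (g5)'s
T5c heads prove (★ `…ToricLevelCensusRamM*` + ★ p857782∕p857781) — taken here as HYPOTHESES in exactly the letters of `toricCensusSum_ramM_v2` (statement-first interface: p06's heads instantiate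
them by name; nothing about their truth is asserted here).  The cells `a > j` are EMPTY in the RAMIFIED frame (★ p858024 `levelSet_eq_empty_of_succ_le_ramified`) and are handled
here, so the per-cell facts are only required on `a ≤ j`.  The result is ONE theorem in the frame letters `hD : IsRamifiedQuadraticDatum ρ α d_ρ t`, `|ϖE| = exp(−2)`, `ρϖE = ϖE`,
`h, h′ ≠ 0`, the token-side facts of ★ T5s (`2 ≤ q`, `1 ≤ g`, `1 ≤ s0`, `jλ ≡ g (2)`, `3g + 2s0 ≤ jλ + 2 + 2(d%2)`, `m ≡ d (2) ∨ window`, `S − 1 ≤ m ≤ jλ`, `ε = 1 ∨ (ε = −1 ∧ window)`) and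
the per-cell facts, whose left side is the census difference in `#levelSetDep` currency (the right side of ★ p858024 `orderCounts_eq_censusSum_ramM`) and whose right side is T5s's
closed form (the input of ★ p857725 `toricCensusSum_ramM_hOrgForm` ∕ (C-6)).
HONEST LABEL: HC_CM is proved only modulo the 7 printed citations (2 remaining named inputs: hLiu418 = stmt-HodgeConjecture-24832,
h413 = stmt-HodgeConjecture-24833) until rung 0 closes; (ρ2b′-X) :418 is an OPEN prover target — this file is a helper (`--supports`), proofs only; the per-cell facts are
hypotheses here (their ★ dischargers are LH4-p06 (g5)'s (C-1)∕(C-2) files), nothing printed is asserted.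

## References
* [Kottwitz1986BaseChangeUnits] R. E. Kottwitz, *Base change for unit elements of Hecke algebras*, Compositio Math. 60 (1986), §1 pp. 240–241.
* [Rogawski1990] J. D. Rogawski, *Automorphic Representations of Unitary Groups in Three Variables*, Ann. of Math. Stud. 123 (1990), §4.9 Prop. 4.9.1 (b) p. 55, Lemma 4.9.3 p. 56.
* [Flicker1998UnitaryFL] Y. Z. Flicker, *Elementary proof of the fundamental lemma for a unitary group*, Canad. J. Math. 50 (1998), Prop. 7 p. 84.
* [Jacobowitz1962] R. Jacobowitz, *Hermitian forms over local fields*, Amer. J. Math. 84 (1962), §4.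
-/

set_option autoImplicit false

open WithZero IsLocalRing Finset
open scoped Valued Classical

namespace Summit.HodgeConjecture.HodgeConjecture.Cruxes.H413.F0P3cDyRamToricLevelCensusRamM

open Literature.NumberTheory.Automorphic.UnitaryThreeFourFrame (IsRamifiedQuadraticDatum)
open Summit.HodgeConjecture.HodgeConjecture.Cruxes.H413.F0P3cDyRamToricCensusDefs
open Summit.HodgeConjecture.HodgeConjecture.Cruxes.H413.F0P3cDyRamToricCensusSumRamMV2 (toricCensusSum_ramM_v2)

variable {K : Type} [Field K] [Valued K ℤᵐ⁰] {ρ Θ : K →+* K} {α ϖE h h' : K} {dρ t : ℕ}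

/-- **THE T5s WELD ON TYPE RamM (modulo the per-cell facts).**  In the RAMIFIED frame (`hD`, `|ϖE| = exp(−2)`, `ρϖE = ϖE`, scalars `h, h′ ≠ 0`), with the token-side facts of
T5s `toricCensusSum_ramM_v2` (`2 ≤ q`, `1 ≤ g`, `1 ≤ s0`, `jλ ≡ g (2)`, `3g + 2s0 ≤ jλ + 2 + 2((g+s0)%2)`, `m ≡ g + s0 (2) ∨ jλ + 2 ≤ m + 2g + s0`, `S − 1 ≤ m ≤ jλ`,
`ε = 1 ∨ (ε = −1 ∧ jλ + 2 ≤ m + 2g + s0)`)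
and the PER-CELL FACTS of the RamM level census in ★ p857711's letters — (C-1P)∕(C-1M): the u-free tables `#levelSet_h(j,a)`, `#levelSet_{h′}(j,a)` (every cell); (C-2GEN)∕(C-2OFF)∕
(C-2TOPnear)∕(C-2TOPfar): on `a ≤ j ≤ jλ`, generic cells pass wholly, off-diagonal non-generic cells are empty, near diagonal top cells agree on the two sides, far ones
carry the bit on side `ε` with value `2q^{j − (j+a−m−s0+1)∕2}` —:
`ε·Σ_{j < jλ+1} Σ_{a < jλ+2} q^a·(#levelSetDep_h(j,a;μ) − #levelSetDep_{h′}(j,a;μ)) = q^m·(2·Σ_{i < (jλ−g)∕2+1} q^i − 2·Σ_{i < (g+s0) − (g+s0)%2} q^i)`.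
[cite: Kottwitz1986BaseChangeUnits, §1 pp. 240–241] [cite: Rogawski1990, §4.9 Prop. 4.9.1 (b) p. 55, Lemma 4.9.3 p. 56] [cite: Flicker1998UnitaryFL, Prop. 7 p. 84] [cite: Jacobowitz1962, §4] -/
theorem toricCensusSum_ramM_weld (hD : IsRamifiedQuadraticDatum ρ α dρ t) (hvΘ : ∀ x, Valued.v (Θ x) = Valued.v x)
    (hρϖ : ρ ϖE = ϖE) (hϖE : Valued.v ϖE = exp (-2 : ℤ)) (hh : h ≠ 0) (hh' : h' ≠ 0)
    (q : ℕ) {g s0 jl m : ℕ} (ε : ℚ) (hq : 2 ≤ q) (hg : 1 ≤ g) (hs0 : 1 ≤ s0) (hjl : jl % 2 = g % 2)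
    (hjlS : 3 * g + 2 * s0 ≤ jl + 2 + 2 * ((g + s0) % 2)) (hparW : m % 2 = (g + s0) % 2 ∨ jl + 2 ≤ m + 2 * g + s0)
    (hmS : g + s0 - (g + s0) % 2 ≤ m + 1) (hm : m ≤ jl) (hε : ε = 1 ∨ (ε = -1 ∧ jl + 2 ≤ m + 2 * g + s0)) {μ : K}
    (hC1P : ∀ j a, (levelSet ρ Θ α ϖE h j a).ncard = (if j = 0 then (if a = 0 then 1 else 0) else if j < a then 0
      else if j - a + 1 = s0 then q ^ j else if j - a + 1 < s0 then (if a = 0 then q ^ j else 0) else if (j - a - s0) % 2 = 1 then 0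
      else if a = 0 then (if 2 * g ≤ j - a - s0 then 2 else 1) * q ^ (j - (j - a - s0) / 2)
      else if j - a - s0 + 2 < 2 * g then (q - 1) * q ^ (j - 1 - (j - a - s0) / 2) else if j - a - s0 + 2 = 2 * g then (q - 2) * q ^ (j - 1 - (j - a - s0) / 2)
      else 2 * (q - 1) * q ^ (j - 1 - (j - a - s0) / 2) : ℕ))
    (hC1M : ∀ j a, (levelSet ρ Θ α ϖE h' j a).ncard = (if j = 0 then (if a = 0 then 1 else 0) else if j < a then 0
      else if j - a + 1 = s0 then q ^ j else if j - a + 1 < s0 then (if a = 0 then q ^ j else 0) else if (j - a - s0) % 2 = 1 then 0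
      else if a = 0 then (if j - a - s0 + 2 ≤ 2 * g then q ^ (j - (j - a - s0) / 2) else 0)
      else if j - a - s0 + 2 < 2 * g then (q - 1) * q ^ (j - 1 - (j - a - s0) / 2) else if j - a - s0 + 2 = 2 * g then q ^ (j - (j - a - s0) / 2) else 0 : ℕ))
    (hC2GEN : ∀ j a, j ≤ jl → a ≤ j → (a ≤ m ∧ (j + a ≤ m ∨ (2 * a ≤ m ∧ j + a ≤ jl))) →
      levelSetDep ρ Θ α ϖE h j a μ = levelSet ρ Θ α ϖE h j a ∧ levelSetDep ρ Θ α ϖE h' j a μ = levelSet ρ Θ α ϖE h' j a)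
    (hC2OFF : ∀ j a, j ≤ jl → a ≤ j → ¬ (a ≤ m ∧ (j + a ≤ m ∨ (2 * a ≤ m ∧ j + a ≤ jl))) → j + m ≠ jl + a →
      levelSetDep ρ Θ α ϖE h j a μ = ∅ ∧ levelSetDep ρ Θ α ϖE h' j a μ = ∅)
    (hC2TOPnear : ∀ j a, j ≤ jl → a ≤ j → ¬ (a ≤ m ∧ (j + a ≤ m ∨ (2 * a ≤ m ∧ j + a ≤ jl))) → j + m = jl + a → j + a + 2 ≤ m + s0 + 2 * g →
      (levelSetDep ρ Θ α ϖE h j a μ).ncard = (levelSetDep ρ Θ α ϖE h' j a μ).ncard)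
    (hC2TOPfar : ∀ j a, j ≤ jl → a ≤ j → ¬ (a ≤ m ∧ (j + a ≤ m ∨ (2 * a ≤ m ∧ j + a ≤ jl))) → j + m = jl + a → ¬ (j + a + 2 ≤ m + s0 + 2 * g) →
      (((levelSetDep ρ Θ α ϖE h j a μ).ncard : ℚ) = if 2 * j + (g + s0) ≤ 2 * jl + 1 ∧ ε = 1 then 2 * (q : ℚ) ^ (j - (j + a - m - s0 + 1) / 2) else 0) ∧
      (((levelSetDep ρ Θ α ϖE h' j a μ).ncard : ℚ) = if 2 * j + (g + s0) ≤ 2 * jl + 1 ∧ ε = -1 then 2 * (q : ℚ) ^ (j - (j + a - m - s0 + 1) / 2) else 0)) :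
    ε * ∑ j ∈ range (jl + 1), ∑ a ∈ range (jl + 2), (q : ℚ) ^ a *
        (((levelSetDep ρ Θ α ϖE h j a μ).ncard : ℚ) - ((levelSetDep ρ Θ α ϖE h' j a μ).ncard : ℚ)) =
      (q : ℚ) ^ m * (2 * ∑ i ∈ range ((jl - g) / 2 + 1), (q : ℚ) ^ i - 2 * ∑ i ∈ range (g + s0 - (g + s0) % 2), (q : ℚ) ^ i) := by
  classical
  -- cells `a > j` are empty on both scalars, with or without the depth condition
  have hEmp : ∀ (s : K), s ≠ 0 → ∀ j a, j < a → levelSet ρ Θ α ϖE s j a = ∅ := fun s hs j a hja =>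
    levelSet_eq_empty_of_succ_le_ramified (Θ := Θ) hD hvΘ hρϖ hϖE hs (by omega)
  have hEmpD : ∀ (s : K), s ≠ 0 → ∀ j a, j < a → ∀ μ' : K, levelSetDep ρ Θ α ϖE s j a μ' = ∅ := fun s hs j a hja μ' =>
    Set.subset_eq_empty (levelSetDep_subset ρ Θ α ϖE s j a μ') (hEmp s hs j a hja)
  -- the tables
  obtain ⟨nP, hnPdef⟩ : ∃ f : ℕ → ℕ → ℚ, f = fun j a => ((levelSet ρ Θ α ϖE h j a).ncard : ℚ) := ⟨_, rfl⟩
  obtain ⟨nM, hnMdef⟩ : ∃ f : ℕ → ℕ → ℚ, f = fun j a => ((levelSet ρ Θ α ϖE h' j a).ncard : ℚ) := ⟨_, rfl⟩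
  obtain ⟨vP, hvPdef⟩ : ∃ f : ℕ → ℕ → ℚ, f = fun j a =>
      if j ≤ jl then ((levelSetDep ρ Θ α ϖE h j a μ).ncard : ℚ) else 0 := ⟨_, rfl⟩
  obtain ⟨vM, hvMdef⟩ : ∃ f : ℕ → ℕ → ℚ, f = fun j a =>
      if j ≤ jl then ((levelSetDep ρ Θ α ϖE h' j a μ).ncard : ℚ) else 0 := ⟨_, rfl⟩
  -- (1) `hnP`, (2) `hnM`: the u-free tables are (C-1P)∕(C-1M), cast
  have hnP : ∀ j a, nP j a = ((if j = 0 then (if a = 0 then 1 else 0) else if j < a then 0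
      else if j - a + 1 = s0 then q ^ j else if j - a + 1 < s0 then (if a = 0 then q ^ j else 0) else if (j - a - s0) % 2 = 1 then 0
      else if a = 0 then (if 2 * g ≤ j - a - s0 then 2 else 1) * q ^ (j - (j - a - s0) / 2)
      else if j - a - s0 + 2 < 2 * g then (q - 1) * q ^ (j - 1 - (j - a - s0) / 2) else if j - a - s0 + 2 = 2 * g then (q - 2) * q ^ (j - 1 - (j - a - s0) / 2)
      else 2 * (q - 1) * q ^ (j - 1 - (j - a - s0) / 2) : ℕ) : ℚ) := fun j a => by
    rw [hnPdef]; dsimp only; rw [hC1P j a]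
  have hnM : ∀ j a, nM j a = ((if j = 0 then (if a = 0 then 1 else 0) else if j < a then 0
      else if j - a + 1 = s0 then q ^ j else if j - a + 1 < s0 then (if a = 0 then q ^ j else 0) else if (j - a - s0) % 2 = 1 then 0
      else if a = 0 then (if j - a - s0 + 2 ≤ 2 * g then q ^ (j - (j - a - s0) / 2) else 0)
      else if j - a - s0 + 2 < 2 * g then (q - 1) * q ^ (j - 1 - (j - a - s0) / 2) else if j - a - s0 + 2 = 2 * g then q ^ (j - (j - a - s0) / 2) else 0 : ℕ) : ℚ) :=
    fun j a => by rw [hnMdef]; dsimp only; rw [hC1M j a]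
  -- (3) `hvGen`: generic cells pass wholly (C-2GEN); `a > j` cells are empty on both counts
  have hvGen : ∀ j a, (a ≤ m ∧ (j + a ≤ m ∨ (2 * a ≤ m ∧ j + a ≤ jl))) → vP j a = nP j a ∧ vM j a = nM j a := by
    intro j a hG
    have hj : j ≤ jl := by omega
    rw [hvPdef, hvMdef, hnPdef, hnMdef]; dsimp only; rw [if_pos hj, if_pos hj]
    by_cases haj : a ≤ j
    · obtain ⟨h1, h2⟩ := hC2GEN j a hj haj hG
      rw [h1, h2]; exact ⟨rfl, rfl⟩
    · rw [hEmpD h hh j a (by omega), hEmpD h' hh' j a (by omega), hEmp h hh j a (by omega), hEmp h' hh' j a (by omega)]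
      exact ⟨rfl, rfl⟩
  -- (4) `hvOff`: off-diagonal non-generic cells are empty (C-2OFF); `a > j` cells and `j > jλ` rows are zero by construction
  have hvOff : ∀ j a, ¬ (a ≤ m ∧ (j + a ≤ m ∨ (2 * a ≤ m ∧ j + a ≤ jl))) → j + m ≠ jl + a → vP j a = 0 ∧ vM j a = 0 := by
    intro j a hnG hoff
    rw [hvPdef, hvMdef]; dsimp only
    by_cases hj : j ≤ jl
    · rw [if_pos hj, if_pos hj]
      by_cases haj : a ≤ j
      · obtain ⟨h1, h2⟩ := hC2OFF j a hj haj hnG hoff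
        rw [h1, h2, Set.ncard_empty, Nat.cast_zero]; exact ⟨rfl, rfl⟩
      · rw [hEmpD h hh j a (by omega), hEmpD h' hh' j a (by omega), Set.ncard_empty, Nat.cast_zero]; exact ⟨rfl, rfl⟩
    · rw [if_neg hj, if_neg hj]; exact ⟨rfl, rfl⟩
  -- (5) `hvTopNear` ∕ `hvTopFar` (C-2TOP): on the diagonal `a ≤ j` is automatic for `j ≤ jλ` (`m ≤ jλ`), and `j > jλ` rows kill the bit
  have hvTopNear : ∀ j a, ¬ (a ≤ m ∧ (j + a ≤ m ∨ (2 * a ≤ m ∧ j + a ≤ jl))) → j + m = jl + a → j + a + 2 ≤ m + s0 + 2 * g → vP j a = vM j a := by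
    intro j a hnG hdiag hnear
    rw [hvPdef, hvMdef]; dsimp only
    by_cases hj : j ≤ jl
    · rw [if_pos hj, if_pos hj, hC2TOPnear j a hj (by omega) hnG hdiag hnear]
    · rw [if_neg hj, if_neg hj]
  have hvTopFar : ∀ j a, ¬ (a ≤ m ∧ (j + a ≤ m ∨ (2 * a ≤ m ∧ j + a ≤ jl))) → j + m = jl + a → ¬ (j + a + 2 ≤ m + s0 + 2 * g) →
      (vP j a = if 2 * j + (g + s0) ≤ 2 * jl + 1 ∧ ε = 1 then 2 * (q : ℚ) ^ (j - (j + a - m - s0 + 1) / 2) else 0) ∧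
      (vM j a = if 2 * j + (g + s0) ≤ 2 * jl + 1 ∧ ε = -1 then 2 * (q : ℚ) ^ (j - (j + a - m - s0 + 1) / 2) else 0) := by
    intro j a hnG hdiag hfar
    rw [hvPdef, hvMdef]; dsimp only
    by_cases hj : j ≤ jl
    · rw [if_pos hj, if_pos hj]
      exact hC2TOPfar j a hj (by omega) hnG hdiag hfar
    · have hbit : ¬ (2 * j + (g + s0) ≤ 2 * jl + 1 ∧ ε = 1) := fun hc => by omega
      have hbit' : ¬ (2 * j + (g + s0) ≤ 2 * jl + 1 ∧ ε = -1) := fun hc => by omega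
      rw [if_neg hj, if_neg hj, if_neg hbit, if_neg hbit']; exact ⟨rfl, rfl⟩
  -- the ★ T5s identity, then unfold the tables on `j ≤ jλ`
  have key := toricCensusSum_ramM_v2 q ε hq hg hs0 hjl hjlS hparW hmS hm hε nP nM vP vM hnP hnM hvGen hvOff hvTopNear hvTopFar
  rw [← key]
  congr 1
  refine sum_congr rfl fun j hj => sum_congr rfl fun a _ => ?_
  have hj' : j ≤ jl := by rw [mem_range] at hj; omega
  rw [hvPdef, hvMdef]; dsimp only; rw [if_pos hj', if_pos hj']

end Summit.HodgeConjecture.HodgeConjecture.Cruxes.H413.F0P3cDyRamToricLevelCensusRamM
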